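import Literature.AnabelianGeometry.EtaleTheta.BiKummerThm44SubBiratPerfection
import Literature.AlgebraicGeometry.Frobenioids.Thm34ConsequencesAsPrinted

/-!
# [EtTh] Theorem 4.4 (ii), clause (a) via [FrdI] Cor. 4.10 AS PRINTED: the T44-L03 input of `Thm44Hyp.cor410_birat` is
# superfluous — cross-cell edge «L2 [EtTh] → L1 [FrdI/II]» (FACT-LIST F-1024), proof-only corollaries

S. Mochizuki, *The étale theta function and its Frobenioid-theoretic manifestations*, Publ. RIMS **45** (2009), Thm. 4.4 (ii)
p.320 (PDF p.94) «`Ψ` induces a 1-compatible equivalence of categories `Ψ^birat : C₁^birat ⥲ C₂^birat`», proof p.321 l.7–10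
«The existence of `Ψ^birat` follows from [FrdI], Corollary 4.10» [cite: MochizukiEtTh2009, Thm 4.4 (ii) p.320 (PDF p.94)];
S. Mochizuki, *The geometry of Frobenioids I*, Kyushu J. Math. **62** (2008), Cor. 4.10 p.90 [cite: MochizukiFrdI2008, Cor. 4.10 p.90].

abc-iut cell, layer L2, seat abc-iut-w5-d123 (gen 5); abc-iut-L2-lead (gen 4) rows **R449 / R471 «ORPHAN SWEEP»** (cross-cell edge
L2 [EtTh] → L1 cleared from the [FrdI/II] side: F-1024 = `PreFrobenioid.cor410_biratData_asPrinted` (p434015), F-1159 =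
`PreFrobenioid.hasFrobeniusLifts` (p407453), F-2393 = `PadicFrd.Datum.slimHypothesisB_of_isOfFSMType` (p427917); rule: «where a LANDED
closer carries an F-xxxx-shaped hypothesis, file a one-theorem proof-only corollary discharging it by the named L1 theorem»).

CENSUS (every landed file under `Literature/AnabelianGeometry/EtaleTheta`, all lineages, 2026-08-26T15:1xZ): NO closer carries an
F-1024 / F-1159 / F-2393-shaped HYPOTHESIS binder — `HasFrobeniusLifts` occurs in no [EtTh] file; `SlimHypothesisB` occurs only as the
CONCLUSION of abc-iut-L2-t3/L6-t13's `TemperedFrobenioid.slimHypothesisB` (`Discharge/Sec3Thm37SubQFT.lean`, Thm. 3.7 (iv)); `Cor410`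
occurs only as the CONCLUSION of abc-iut-w5-d124's `Thm44Hyp.cor410_birat` family (`BiKummerThm44SubBiratPerfection(Weak).lean`).  The
one place the L1 theorem DOES bite is that conclusion: `Thm44Hyp.cor410_birat` derives [FrdI] Cor. 4.10 at `(C₁, C₂, Ψ)` from L1's
`cor410_biratData` PLUS the T44-L03 input `h3 : h.PreservesFrobeniusStructure` («`Ψ`, `Ψ⁻¹` preserve co-angular pre-steps»), whereas
L1's AS-PRINTED form `cor410_biratData_asPrinted` (abc-iut-L1, F-1024 ✓) derives those two preservation inputs ITSELF from the printed
antecedents of Cor. 4.10 (FSMFF-type bases, quasi-isotropic type — antecedents INSIDE the typed `PreFrobenioidData.Cor410`).  Hence: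
* `BiKummerSetting.cor410_birat_of_equivalence` — Cor. 4.10 AS TYPED at THE birationalizations of the two tempered Frobenioids for ANY
  equivalence `Ψ : C₁ ≌ C₂` of the underlying categories, inputs «`C_i` Frobenioid» ONLY (no `Thm44Hyp`, no T44-L03);
* `Thm44Hyp.cor410_birat_asPrinted` — abc-iut-w5-d124's `cor410_birat` WITHOUT `h3`;
* `Thm44Hyp.cor410_birat_treeVocab_asPrinted` / `…_mkOfConnectedTemperoid_asPrinted` — the tree-vocabulary / genuine-connected-base forms
  with ONLY `hBmon_i` ([FrdI] Thm. 5.2 preamble «`𝔹` a monoid on `D`»): the Rmk. 3.7.2 inputs `h372`, `h372'` of `cor410_birat_treeVocab` /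
  `cor410_birat_mkOfConnectedTemperoid` (used there only to manufacture T44-L03) are GONE as well.
So on the L2 side of the edge the F-1024 row is consumed BY NAME and sheds three binders of the Thm. 4.4 (ii) chain (`h3`, `h372`, `h372'`)
for its Cor. 4.10 clause; T44-L11 (perfection compatibility) still uses T44-L03 and is untouched.
HONEST FRAMING: kernel-checked corollaries of abc-iut-L1's theorem over abc-iut-L2-t3's / abc-iut-w5-d124's typed structures; [EtTh] and
[FrdI] are refereed; nothing here bears on [IUTchIII] Cor. 3.12; no side taken; typed ≠ proved for anything not displayed. -/

namespace Literature.AnabelianGeometry.EtaleTheta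

open CategoryTheory Opposite Literature.AlgebraicGeometry.Frobenioids Literature.AnabelianGeometry.SemiGraphs

namespace BiKummerSetting

universe u₀ v₀ u v w

/-! ### Any pair of settings, any monoid vocabulary: «`C_i` Frobenioid» only -/

section AnySetting

variable {K : Type u₀} [Field K] {K' : Type u₀} [Field K'] {D₀ : Type u₀} [Category.{v₀} D₀]
  {V : FrdIMonoidStub.{w}}
  {X₁ : SemiGraphs.TemperedArithmeticGroup.{u₀} K} {X₂ : SemiGraphs.TemperedArithmeticGroup.{u₀} K'}
  {D₀' : Type u₀} [Category.{v₀} D₀']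
  {T₁ : RealifiedDivisorMonoids (D₀ := D₀) V} {T₂ : RealifiedDivisorMonoids (D₀ := D₀') V}
  {D₁ D₂ : Type u} [Category.{v} D₁] [Category.{v} D₂] {VD₁ : FrdICatStub.{u, v, w} D₁}
  {VD₂ : FrdICatStub.{u, v, w} D₂} {S₁ : BiKummerSetting X₁ T₁ D₁ VD₁} {S₂ : BiKummerSetting X₂ T₂ D₂ VD₂}

/-- **[FrdI] Cor. 4.10 AS TYPED at THE birationalizations of two tempered Frobenioids, for ANY equivalence `Ψ : C₁ ≌ C₂`** — inputs
«`C_i` is a Frobenioid» only: abc-iut-L1's AS-PRINTED `PreFrobenioid.cor410_biratData_asPrinted` (F-1024; the FSMFF / quasi-isotropic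
antecedents live inside `PreFrobenioidData.Cor410`).  No `Thm44Hyp`, no T44-L03.
[cite: MochizukiEtTh2009, Thm 4.4 (ii) p.320 (PDF p.94)] [cite: MochizukiFrdI2008, Cor. 4.10 p.90] -/
theorem cor410_birat_of_equivalence (Ψ : S₁.C ≌ S₂.C) (hF₁ : PreFrobenioid.IsFrobenioid S₁.F)
    (hF₂ : PreFrobenioid.IsFrobenioid S₂.F) :
    PreFrobenioidData.Cor410 (PreFrobenioidData.ofFunctor S₁.tf.divisorMonoid S₁.F)
      (PreFrobenioidData.ofFunctor S₂.tf.divisorMonoid S₂.F) Ψ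
      (PreFrobenioid.biratData hF₁ (PreFrobenioid.hasBiratSquares_of_isFrobenioid hF₁))
      (PreFrobenioid.biratData hF₂ (PreFrobenioid.hasBiratSquares_of_isFrobenioid hF₂)) :=
  PreFrobenioid.cor410_biratData_asPrinted hF₁ _ hF₂ _ Ψ

/-- **abc-iut-w5-d124's `Thm44Hyp.cor410_birat` WITHOUT its T44-L03 input `h3`** (the preservation of co-angular pre-steps by `Ψ`, `Ψ⁻¹`
is supplied by the as-printed Cor. 4.10 itself).  [cite: MochizukiEtTh2009, Thm 4.4 (ii) p.320 (PDF p.94)] [cite: MochizukiFrdI2008, Cor. 4.10 p.90] -/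
theorem Thm44Hyp.cor410_birat_asPrinted (h : Thm44Hyp S₁ S₂) (hF₁ : PreFrobenioid.IsFrobenioid S₁.F)
    (hF₂ : PreFrobenioid.IsFrobenioid S₂.F) :
    PreFrobenioidData.Cor410 (PreFrobenioidData.ofFunctor S₁.tf.divisorMonoid S₁.F)
      (PreFrobenioidData.ofFunctor S₂.tf.divisorMonoid S₂.F) h.Ψ
      (PreFrobenioid.biratData hF₁ (PreFrobenioid.hasBiratSquares_of_isFrobenioid hF₁))
      (PreFrobenioid.biratData hF₂ (PreFrobenioid.hasBiratSquares_of_isFrobenioid hF₂)) :=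
  cor410_birat_of_equivalence h.Ψ hF₁ hF₂

end AnySetting

/-! ### Tree vocabularies: the Rmk. 3.7.2 inputs are gone as well (`hBmon_i` only) -/

section TreeVocab

variable {K : Type u₀} [Field K] {K' : Type u₀} [Field K'] {D₀ : Type u₀} [Category.{v₀} D₀]
  {X₁ : SemiGraphs.TemperedArithmeticGroup.{u₀} K} {X₂ : SemiGraphs.TemperedArithmeticGroup.{u₀} K'}
  {D₀' : Type u₀} [Category.{v₀} D₀']
  {T₁ : RealifiedDivisorMonoids (D₀ := D₀) treeMonoidVocab.{w}}
  {T₂ : RealifiedDivisorMonoids (D₀ := D₀') treeMonoidVocab.{w}}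
  {D₁ D₂ : Type u} [Category.{v} D₁] [Category.{v} D₂]
  {IsRational₁ IsStrictlyRational₁ : (D₁ᵒᵖ ⥤ CommMonCat.{w}) → Prop}
  {IsRational₂ IsStrictlyRational₂ : (D₂ᵒᵖ ⥤ CommMonCat.{w}) → Prop}
  {S₁ : BiKummerSetting X₁ T₁ D₁ (treeCatVocab D₁ IsRational₁ IsStrictlyRational₁)}
  {S₂ : BiKummerSetting X₂ T₂ D₂ (treeCatVocab D₂ IsRational₂ IsStrictlyRational₂)}

/-- **[FrdI] Cor. 4.10 AS TYPED at `(C₁, C₂, Ψ)`, tree vocabularies, from `hBmon_i` ALONE** («`C_i` is a Frobenioid» by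
`isFrobenioid_treeCatVocab_of_isMonoidOn`, [FrdI] Thm. 5.2 (i); no Rmk. 3.7.2, no T44-L03) — abc-iut-w5-d124's
`cor410_birat_treeVocab` without `h372`, `h372'`.  [cite: MochizukiEtTh2009, Thm 4.4 (ii) p.320 (PDF p.94)] [cite: MochizukiFrdI2008, Cor. 4.10 p.90] -/
theorem Thm44Hyp.cor410_birat_treeVocab_asPrinted (h : Thm44Hyp S₁ S₂)
    (hBmon₁ : IsMonoidOn S₁.tf.ratFnFunctor) (hBmon₂ : IsMonoidOn S₂.tf.ratFnFunctor) :
    PreFrobenioidData.Cor410 (PreFrobenioidData.ofFunctor S₁.tf.divisorMonoid S₁.F)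
      (PreFrobenioidData.ofFunctor S₂.tf.divisorMonoid S₂.F) h.Ψ
      (PreFrobenioid.biratData (S₁.tf.isFrobenioid_treeCatVocab_of_isMonoidOn hBmon₁)
        (PreFrobenioid.hasBiratSquares_of_isFrobenioid (S₁.tf.isFrobenioid_treeCatVocab_of_isMonoidOn hBmon₁)))
      (PreFrobenioid.biratData (S₂.tf.isFrobenioid_treeCatVocab_of_isMonoidOn hBmon₂)
        (PreFrobenioid.hasBiratSquares_of_isFrobenioid (S₂.tf.isFrobenioid_treeCatVocab_of_isMonoidOn hBmon₂))) :=
  h.cor410_birat_asPrinted _ _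

end TreeVocab

/-! ### The genuine connected bases `B^temp(Π^tp_{X_i})⁰` -/

section Connected

variable {K : Type u₀} [Field K] {K' : Type u₀} [Field K'] {X₁ : SemiGraphs.TemperedArithmeticGroup.{u₀} K}
  {X₂ : SemiGraphs.TemperedArithmeticGroup.{u₀} K'} {D₀ : Type u₀} [Category.{v₀} D₀] {D₀' : Type u₀} [Category.{v₀} D₀']
  {T₁ : RealifiedDivisorMonoids (D₀ := D₀) treeMonoidVocab.{w}} {T₂ : RealifiedDivisorMonoids (D₀ := D₀') treeMonoidVocab.{w}}
  {IsRational₁ IsStrictlyRational₁ : ((ConnectedPart (BTemp X₁.Pi))ᵒᵖ ⥤ CommMonCat.{w}) → Prop}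
  {IsRational₂ IsStrictlyRational₂ : ((ConnectedPart (BTemp X₂.Pi))ᵒᵖ ⥤ CommMonCat.{w}) → Prop}
  {tf₁ : TemperedFrobenioid T₁ (ConnectedPart (BTemp X₁.Pi))
    (treeCatVocab (ConnectedPart (BTemp X₁.Pi)) IsRational₁ IsStrictlyRational₁)}
  {hZ₁ : tf₁.monoidType = MonoidType.Z} {hP₁ : ∀ B : (ConnectedPart (BTemp X₁.Pi))ᵒᵖ, IsPerfect (tf₁.Φ.carrier B)}
  {NH₁ : Subgroup (Field.absoluteGaloisGroup K) → tf₁.category → ℕ+ → Prop} {A₁ : tf₁.category}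
  {hA₁ : PreFrobenioid.IsFrobeniusTrivial tf₁.toElem A₁} {hA₁' : SemiGraphs.IsGaloisObj A₁.base.obj}
  {tf₂ : TemperedFrobenioid T₂ (ConnectedPart (BTemp X₂.Pi))
    (treeCatVocab (ConnectedPart (BTemp X₂.Pi)) IsRational₂ IsStrictlyRational₂)}
  {hZ₂ : tf₂.monoidType = MonoidType.Z} {hP₂ : ∀ B : (ConnectedPart (BTemp X₂.Pi))ᵒᵖ, IsPerfect (tf₂.Φ.carrier B)}
  {NH₂ : Subgroup (Field.absoluteGaloisGroup K') → tf₂.category → ℕ+ → Prop} {A₂ : tf₂.category}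
  {hA₂ : PreFrobenioid.IsFrobeniusTrivial tf₂.toElem A₂} {hA₂' : SemiGraphs.IsGaloisObj A₂.base.obj}

/-- **[FrdI] Cor. 4.10 AS TYPED at `(C₁, C₂, Ψ)` over the genuine connected bases, from `hBmon_i` ALONE** — abc-iut-w5-d124's
`cor410_birat_mkOfConnectedTemperoid` without `h372`, `h372'`.  [cite: MochizukiEtTh2009, Thm 4.4 (ii) p.320 (PDF p.94)] [cite: MochizukiFrdI2008, Cor. 4.10 p.90] -/
theorem Thm44Hyp.cor410_birat_mkOfConnectedTemperoid_asPrinted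
    (h : Thm44Hyp (mkOfConnectedTemperoid X₁ tf₁ hZ₁ hP₁ NH₁ A₁ hA₁ hA₁')
      (mkOfConnectedTemperoid X₂ tf₂ hZ₂ hP₂ NH₂ A₂ hA₂ hA₂'))
    (hBmon₁ : IsMonoidOn tf₁.ratFnFunctor) (hBmon₂ : IsMonoidOn tf₂.ratFnFunctor) :
    PreFrobenioidData.Cor410 (PreFrobenioidData.ofFunctor tf₁.divisorMonoid tf₁.toElem)
      (PreFrobenioidData.ofFunctor tf₂.divisorMonoid tf₂.toElem) h.Ψ
      (PreFrobenioid.biratData (tf₁.isFrobenioid_treeCatVocab_of_isMonoidOn hBmon₁)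
        (PreFrobenioid.hasBiratSquares_of_isFrobenioid (tf₁.isFrobenioid_treeCatVocab_of_isMonoidOn hBmon₁)))
      (PreFrobenioid.biratData (tf₂.isFrobenioid_treeCatVocab_of_isMonoidOn hBmon₂)
        (PreFrobenioid.hasBiratSquares_of_isFrobenioid (tf₂.isFrobenioid_treeCatVocab_of_isMonoidOn hBmon₂))) :=
  h.cor410_birat_treeVocab_asPrinted hBmon₁ hBmon₂

end Connected

end BiKummerSetting

end Literature.AnabelianGeometry.EtaleTheta

-- tree-health (abc-iut-w6-d081 g4, 2026-08-26T16:17Z): comment-only re-land of a STRANDED ACCEPT (accepted 15:13–15:14Z, farm import probe hangs «stale:unbuilt» at 16:0xZ, ≥ 50 min);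
-- declarations byte-identical; rule of record: a re-land outside a reload window is served in 10–27 min (13/13 on 2026-08-26).
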